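import Mathlib
import Summits.NavierStokesRegularity.NavierStokesRegularity.Theorems.EulerZoomLiouvillePowerGaugeEulerLiouvilleLogtimeBreatherFiniteEnergy
import HarnessLib

/-!
# FINITE-ENERGY SLOW POWER CLOCKS (`g < 2/5`) are trivial; at the ENDPOINT `ρ = ½` every power clock with `g ≠ 2/5` is trivial
# (crux `EulerZoomLiouville.PowerGaugeEulerLiouville` = stmt-NavierStokesRegularity-19832; line `logtime-breathers` of ns-idea-11, a bite out of the
# residue T4 `stub_powerClockRest` — member-level fillers, WEAK class, NO regularity, NO tameness)

Route `EulerZoomLiouville` (NavierStokesRegularity); width seat ns-ezl-w4 g2; sequel of `…LogtimeBreatherFiniteEnergy` (same ENERGY lever).  A POWER CLOCK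
about `T₀` with exponent `g` and profile `W` is a member with `u(τ, y) = (T₀−τ)^{g−1} W((T₀−τ)^{−g} y)` for `τ < T₁` (`T₁ ≤ T₀`, so the clock
`s = T₀ − τ` is positive; arbitrary on `[T₁, 0)`).  Its slice energy is

> `∫_{ℝ³} |u(τ)|² = s^{2(g−1)} · s^{3g} ∫_{ℝ³} |W|² = s^{5g−2} ‖W‖²₂`, `s = T₀ − τ → +∞` as `τ → −∞`;

so for a SLOW exponent `g < 2/5` and a FINITE-ENERGY profile `W ∈ L²` the energy tends to ZERO in the far past, the past is energy-quiescent and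
the crux's filled stratum `ae_eq_zero_of_gauge_of_energyVanishing_allRho` makes the member vanish on the whole slab (any `ρ ≥ 0`, any `T₀ ≥ T₁`; at
`T₀ = 0` the tree's `PastShape.…slowPowerClock` covers `g < 1/(2+ρ)` with arbitrary profile, but about `T₀ > 0` the slow clocks were OPEN).  At the
ENDPOINT `ρ = ½` the hypothesis `W ∈ L²` is AUTOMATIC (every slice has energy `≤ c`, `lintegral_enorm_sq_le_of_gauge_half`), and `2/5` is exactly both the
class rate `γ = 1/(2+ρ)` and the fast threshold `½ − ρ/5`: with `PastShape.…pastFastPowerClock` (`g > 2/5`, any profile) EVERY power clock with `g ≠ 2/5`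
is trivial at `ρ = ½`.  Together with `…LogtimeBreatherFiniteEnergy` and T1, the classical shape-preserving chapter at the endpoint reduces to the exactly
self-similar members (rate `2/5`, about some `T₀ ≥ 0`) — the registered self-similar residue — and nothing else.

* `PowerClock.lintegral_enorm_sq_shape_univ` — `∫⁻ ‖θ • V(ℓ⁻¹ • y)‖ₑ² = ofReal(θ² ℓ³) · ∫⁻ ‖V‖ₑ²` (whole space, no measurability);
* `PowerClock.lintegral_enorm_sq_clockSlice_univ` — the slice identity `∫⁻ ‖u(τ)‖ₑ² = ofReal((T₀−τ)^{5g−2}) · ∫⁻ ‖W‖ₑ²`;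
* `PowerClock.ae_eq_zero_of_gauge_of_finiteEnergySlowClock` — MEMBER LEVEL, crux hypotheses verbatim (any `ρ ≥ 0`) + `g < 2/5` + the representation for
  `τ < T₁ ≤ T₀` + `∫⁻ ‖W‖ₑ² < ∞` ⇒ `u = 0` a.e. on `(−∞,0) × ℝ³`;
* `PowerClock.lintegral_enorm_sq_profile_lt_top_of_gauge_half` — `ρ = ½`: the `A`-gauge alone gives `∫⁻ ‖W‖ₑ² < ∞`;
* `PowerClock.ae_eq_zero_of_gauge_half_of_slowClock` / `PowerClock.ae_eq_zero_of_gauge_half_of_clock_ne` — ENDPOINT: every power clock with `g < 2/5` /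
  with `g ≠ 2/5` (any `T₀ ≥ T₁`, `T₁ ≤ 0`, any profile) is trivial.

WHAT THIS IS NOT: not NS, not E — one more stratum of the crux CLASS 19832 on the MODEL lattice, `--supports` stmt-19832; the infinite-energy window clocks
(`ρ < ½`) and the rate-`2/5` self-similar members stay OPEN. [folklore; line card `Cruxes/PowerGaugeEulerLiouville/Lines/logtime-breathers.md` T4]
-/

noncomputable section

-- flat `Theorems/<Route><Decl>…` files of one crux share the namespace of the crux (tree convention: `Summit.<S>.<S>.…`)
set_option linter.dupNamespace false

open MeasureTheory Set Filter Topology Metric Function TopologicalSpace Module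
open scoped ENNReal NNReal

namespace Summit.NavierStokesRegularity.NavierStokesRegularity.Theorems.PowerGaugeEulerLiouville

open Literature.Analysis Literature.Analysis.FunctionSpaces Literature.Analysis.FluidPDE

namespace PowerClock

variable {u : ℝ → EuclideanSpace ℝ (Fin 3) → EuclideanSpace ℝ (Fin 3)} {p : ℝ → EuclideanSpace ℝ (Fin 3) → ℝ}
  {H : ℝ → EuclideanSpace ℝ (Fin 3) → EuclideanSpace ℝ (Fin 3) →L[ℝ] EuclideanSpace ℝ (Fin 3)} {c : ℝ≥0}

/-! ### Whole-space slice identities -/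

/-- **Total energy of a shape-preserving slice.**  `∫_{ℝ³} ‖θ V(y/ℓ)‖² dy = θ² ℓ³ ∫_{ℝ³} ‖V‖²` (`ℓ > 0`; lower integrals, no measurability;
the whole-space twin of `PastShape.lintegral_ball_shape`). [folklore] -/
theorem lintegral_enorm_sq_shape_univ (θ : ℝ) {ℓ : ℝ} (hℓ : 0 < ℓ)
    (V : EuclideanSpace ℝ (Fin 3) → EuclideanSpace ℝ (Fin 3)) :
    ∫⁻ y, ‖θ • V (ℓ⁻¹ • y)‖ₑ ^ 2 = ENNReal.ofReal (θ ^ 2 * ℓ ^ 3) * ∫⁻ z, ‖V z‖ₑ ^ 2 := by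
  have hθ : ∀ y : EuclideanSpace ℝ (Fin 3),
      ‖θ • V (ℓ⁻¹ • y)‖ₑ ^ 2 = ENNReal.ofReal (θ ^ 2) * ‖V (ℓ⁻¹ • y)‖ₑ ^ 2 := by
    intro y
    rw [enorm_smul, mul_pow, Real.enorm_eq_ofReal_abs, ← ENNReal.ofReal_pow (abs_nonneg θ), sq_abs]
  simp_rw [hθ]
  rw [lintegral_const_mul' _ _ ENNReal.ofReal_ne_top,
    LogtimeBreather.lintegral_comp_smul_univ (fun z : EuclideanSpace ℝ (Fin 3) => ‖V z‖ₑ ^ 2) (inv_pos.2 hℓ), ← mul_assoc,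
    ← ENNReal.ofReal_mul (sq_nonneg θ), inv_pow, inv_inv]

/-- The clock algebra `(s^{g−1})² (s^{g})³ = s^{5g−2}` (`s > 0`). [folklore] -/
theorem clock_pow_eq {s : ℝ} (hs : 0 < s) (g : ℝ) : (s ^ (g - 1)) ^ 2 * (s ^ g) ^ 3 = s ^ (5 * g - 2) := by
  rw [← Real.rpow_natCast (s ^ (g - 1)) 2, ← Real.rpow_natCast (s ^ g) 3, ← Real.rpow_mul hs.le, ← Real.rpow_mul hs.le,
    ← Real.rpow_add hs]
  congr 1
  push_cast
  ring

/-- **Total energy of a power-clock slice.**  If `u(τ, y) = (T₀−τ)^{g−1} W((T₀−τ)^{−g} y)` with `τ < T₀`, then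
`∫_{ℝ³} ‖u(τ)‖² = (T₀−τ)^{5g−2} ∫_{ℝ³} ‖W‖²` (lower integrals). [folklore] -/
theorem lintegral_enorm_sq_clockSlice_univ {T₀ g τ : ℝ} (hτ : τ < T₀)
    {W : EuclideanSpace ℝ (Fin 3) → EuclideanSpace ℝ (Fin 3)}
    (hu : ∀ y, u τ y = (T₀ - τ) ^ (g - 1) • W ((T₀ - τ) ^ (-g) • y)) :
    ∫⁻ y, ‖u τ y‖ₑ ^ 2 = ENNReal.ofReal ((T₀ - τ) ^ (5 * g - 2)) * ∫⁻ z, ‖W z‖ₑ ^ 2 := by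
  have hs : 0 < T₀ - τ := by linarith
  have hfun : (fun y => ‖u τ y‖ₑ ^ 2) = fun y => ‖(T₀ - τ) ^ (g - 1) • W (((T₀ - τ) ^ g)⁻¹ • y)‖ₑ ^ 2 := by
    funext y; rw [hu y, Real.rpow_neg hs.le]
  rw [hfun, lintegral_enorm_sq_shape_univ _ (Real.rpow_pos_of_pos hs g) W, clock_pow_eq hs g]

/-! ### Finite-energy slow clocks (any `ρ ≥ 0`, any `T₀ ≥ T₁`) -/

/-- **FINITE-ENERGY SLOW POWER CLOCKS ARE TRIVIAL** (crux hypotheses verbatim — suitable weak Euler pair on the slab, weak gradient, the three power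
gauges —, any `ρ ≥ 0`; no regularity, no tameness): if `u(τ, y) = (T₀−τ)^{g−1} W((T₀−τ)^{−g} y)` for all `τ < T₁` with `T₁ ≤ T₀` (any `T₀`;
only `τ < 0` matters), `g < 2/5` and `∫_{ℝ³}‖W‖² < ∞`, then `u = 0` a.e. on `(−∞,0) × ℝ³`: the slice energy `(T₀−τ)^{5g−2}‖W‖²₂` tends to `0` as
`τ → −∞`, and `ae_eq_zero_of_gauge_of_energyVanishing_allRho` concludes. [folklore] -/
theorem ae_eq_zero_of_gauge_of_finiteEnergySlowClock {ρ : ℝ} (hρ : 0 ≤ ρ)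
    (hsw : IsSuitableWeakSolutionOn (slab (EuclideanSpace ℝ (Fin 3)) (Iio 0) isOpen_Iio) 0 0 u p)
    (hH : HasWeakSpatialGradientOn (slab (EuclideanSpace ℝ (Fin 3)) (Iio 0) isOpen_Iio) u H)
    (hgauge : ∀ a : ℝ, 0 < a →
      ENNReal.ofReal (a ^ (2 * ρ)) * cknA a (0 : ℝ × EuclideanSpace ℝ (Fin 3)) u +
          ENNReal.ofReal (a ^ ρ) * cknE a (0 : ℝ × EuclideanSpace ℝ (Fin 3)) H +
        ENNReal.ofReal (a ^ (2 * ρ)) * cknD a (0 : ℝ × EuclideanSpace ℝ (Fin 3)) p ≤ (c : ℝ≥0∞))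
    {T₁ T₀ g : ℝ} (hT₁T₀ : T₁ ≤ T₀) (hg : g < 2 / 5) {W : EuclideanSpace ℝ (Fin 3) → EuclideanSpace ℝ (Fin 3)}
    (hW : ∀ τ : ℝ, τ < T₁ → ∀ y, u τ y = (T₀ - τ) ^ (g - 1) • W ((T₀ - τ) ^ (-g) • y))
    (hWE : ∫⁻ z, ‖W z‖ₑ ^ 2 < ∞) :
    uncurry u =ᵐ[volume.restrict (Iio (0 : ℝ) ×ˢ (univ : Set (EuclideanSpace ℝ (Fin 3))))] 0 := by
  set J : ℝ≥0∞ := ∫⁻ z, ‖W z‖ₑ ^ 2 with hJ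
  have hJr : J = ENNReal.ofReal J.toReal := (ENNReal.ofReal_toReal hWE.ne).symm
  have hslice : ∀ τ : ℝ, τ < T₁ → ∫⁻ y, ‖u τ y‖ₑ ^ 2 = ENNReal.ofReal ((T₀ - τ) ^ (5 * g - 2)) * J :=
    fun τ hτ => lintegral_enorm_sq_clockSlice_univ (lt_of_lt_of_le hτ hT₁T₀) (hW τ hτ)
  refine ae_eq_zero_of_gauge_of_energyVanishing_allRho hρ hsw hH hgauge fun ε hε N => ?_
  -- `(T₀ − τ)^{5g−2} J.toReal → 0` as `τ → −∞`
  have he : 0 < 2 - 5 * g := by linarith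
  have hclock : Tendsto (fun τ : ℝ => T₀ - τ) atBot atTop := by
    have h := tendsto_atTop_add_const_left atBot T₀ tendsto_neg_atBot_atTop
    refine h.congr fun τ => ?_
    ring
  have htend : Tendsto (fun τ : ℝ => (T₀ - τ) ^ (5 * g - 2) * J.toReal) atBot (𝓝 (0 * J.toReal)) := by
    refine Tendsto.mul ?_ tendsto_const_nhds
    have h := (tendsto_rpow_neg_atTop he).comp hclock
    refine h.congr fun τ => ?_
    simp only [Function.comp_apply]
    congr 1
    ring
  rw [zero_mul] at htend
  obtain ⟨s₀, hs₀⟩ :=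
    ((htend.eventually (Iio_mem_nhds hε)).and (eventually_lt_atBot (min (-N) T₁))).exists_forall_of_atBot
  have hsub : Iic s₀ ⊆ {s : ℝ | s < -N ∧ ∫⁻ x, ‖u s x‖ₑ ^ 2 ≤ ENNReal.ofReal ε} := by
    intro s hs
    obtain ⟨hlt, hsm⟩ := hs₀ s hs
    rw [lt_min_iff] at hsm
    refine ⟨hsm.1, ?_⟩
    have hs0 : 0 < T₀ - s := by linarith [hsm.2]
    rw [hslice s hsm.2, hJr, ← ENNReal.ofReal_mul (Real.rpow_pos_of_pos hs0 _).le]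
    exact ENNReal.ofReal_le_ofReal hlt.le
  have hinf : volume (Iic s₀) = (⊤ : ℝ≥0∞) := Real.volume_Iic
  intro h0
  have := measure_mono_null hsub h0
  rw [hinf] at this
  exact ENNReal.top_ne_zero this

/-! ### The endpoint `ρ = ½`: every power clock with `g ≠ 2/5` is trivial -/

/-- **At `ρ = ½` the profile of a power clock on a past sub-slab has finite energy** (the `A`-gauge alone): the slice `τ = T₁ − 1 < 0` has energy `≤ c`
(`lintegral_enorm_sq_le_of_gauge_half`) and equals `(T₀−τ)^{5g−2}‖W‖²₂` with a positive clock factor. [folklore] -/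
theorem lintegral_enorm_sq_profile_lt_top_of_gauge_half
    (hA : ∀ a : ℝ, 0 < a →
      ENNReal.ofReal (a ^ (2 * (1 / 2 : ℝ))) * cknA a (0 : ℝ × EuclideanSpace ℝ (Fin 3)) u ≤ (c : ℝ≥0∞))
    {T₁ T₀ g : ℝ} (hT₁ : T₁ ≤ 0) (hT₁T₀ : T₁ ≤ T₀) {W : EuclideanSpace ℝ (Fin 3) → EuclideanSpace ℝ (Fin 3)}
    (hW : ∀ τ : ℝ, τ < T₁ → ∀ y, u τ y = (T₀ - τ) ^ (g - 1) • W ((T₀ - τ) ^ (-g) • y)) :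
    ∫⁻ z, ‖W z‖ₑ ^ 2 < ∞ := by
  set τ : ℝ := T₁ - 1 with hτ
  have hτT : τ < T₁ := by rw [hτ]; linarith
  have hτ0 : τ < 0 := by linarith
  have hs : 0 < T₀ - τ := by linarith
  have hE : ∫⁻ x, ‖u τ x‖ₑ ^ 2 ≤ (c : ℝ≥0∞) := lintegral_enorm_sq_le_of_gauge_half hA hτ0
  rw [lintegral_enorm_sq_clockSlice_univ (lt_of_lt_of_le hτT hT₁T₀) (hW τ hτT)] at hE
  have hpos : ENNReal.ofReal ((T₀ - τ) ^ (5 * g - 2)) ≠ 0 := by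
    rw [ENNReal.ofReal_ne_zero_iff]; exact Real.rpow_pos_of_pos hs _
  rw [lt_top_iff_ne_top]
  intro hJ
  rw [hJ, ENNReal.mul_top hpos] at hE
  exact ENNReal.coe_ne_top (top_le_iff.1 hE)

/-- **ENDPOINT `ρ = ½`: SLOW POWER CLOCKS (`g < 2/5`) ARE TRIVIAL, ANY PROFILE** (crux hypotheses verbatim at `ρ = ½`; weak class, no regularity; the
representation for `τ < T₁`, `T₁ ≤ 0`, `T₁ ≤ T₀`). [folklore] -/
theorem ae_eq_zero_of_gauge_half_of_slowClock
    (hsw : IsSuitableWeakSolutionOn (slab (EuclideanSpace ℝ (Fin 3)) (Iio 0) isOpen_Iio) 0 0 u p)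
    (hH : HasWeakSpatialGradientOn (slab (EuclideanSpace ℝ (Fin 3)) (Iio 0) isOpen_Iio) u H)
    (hgauge : ∀ a : ℝ, 0 < a →
      ENNReal.ofReal (a ^ (2 * (1 / 2 : ℝ))) * cknA a (0 : ℝ × EuclideanSpace ℝ (Fin 3)) u +
          ENNReal.ofReal (a ^ (1 / 2 : ℝ)) * cknE a (0 : ℝ × EuclideanSpace ℝ (Fin 3)) H +
        ENNReal.ofReal (a ^ (2 * (1 / 2 : ℝ))) * cknD a (0 : ℝ × EuclideanSpace ℝ (Fin 3)) p ≤ (c : ℝ≥0∞))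
    {T₁ T₀ g : ℝ} (hT₁ : T₁ ≤ 0) (hT₁T₀ : T₁ ≤ T₀) (hg : g < 2 / 5) {W : EuclideanSpace ℝ (Fin 3) → EuclideanSpace ℝ (Fin 3)}
    (hW : ∀ τ : ℝ, τ < T₁ → ∀ y, u τ y = (T₀ - τ) ^ (g - 1) • W ((T₀ - τ) ^ (-g) • y)) :
    uncurry u =ᵐ[volume.restrict (Iio (0 : ℝ) ×ˢ (univ : Set (EuclideanSpace ℝ (Fin 3))))] 0 :=
  have hA : ∀ a : ℝ, 0 < a → ENNReal.ofReal (a ^ (2 * (1 / 2 : ℝ))) *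
      cknA a (0 : ℝ × EuclideanSpace ℝ (Fin 3)) u ≤ (c : ℝ≥0∞) :=
    fun a ha => le_trans (le_trans le_self_add le_self_add) (hgauge a ha)
  ae_eq_zero_of_gauge_of_finiteEnergySlowClock (ρ := 1 / 2) (by norm_num) hsw hH hgauge hT₁T₀ hg hW
    (lintegral_enorm_sq_profile_lt_top_of_gauge_half hA hT₁ hT₁T₀ hW)

/-- **ENDPOINT `ρ = ½`: EVERY POWER CLOCK WITH `g ≠ 2/5` IS TRIVIAL** (crux hypotheses verbatim at `ρ = ½`; weak class, no regularity, any profile, any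
`T₀ ≥ T₁`, `T₁ ≤ 0`): `g < 2/5` by `ae_eq_zero_of_gauge_half_of_slowClock`, `g > 2/5 = ½ − ρ/5` by the tree's `PastShape.ae_eq_zero_of_gauge_of_pastFastPowerClock`.
`2/5 = 1/(2+ρ)` is the class rate: only the exactly self-similar clocks survive at the endpoint. [folklore] -/
theorem ae_eq_zero_of_gauge_half_of_clock_ne
    (hsw : IsSuitableWeakSolutionOn (slab (EuclideanSpace ℝ (Fin 3)) (Iio 0) isOpen_Iio) 0 0 u p)
    (hH : HasWeakSpatialGradientOn (slab (EuclideanSpace ℝ (Fin 3)) (Iio 0) isOpen_Iio) u H)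
    (hgauge : ∀ a : ℝ, 0 < a →
      ENNReal.ofReal (a ^ (2 * (1 / 2 : ℝ))) * cknA a (0 : ℝ × EuclideanSpace ℝ (Fin 3)) u +
          ENNReal.ofReal (a ^ (1 / 2 : ℝ)) * cknE a (0 : ℝ × EuclideanSpace ℝ (Fin 3)) H +
        ENNReal.ofReal (a ^ (2 * (1 / 2 : ℝ))) * cknD a (0 : ℝ × EuclideanSpace ℝ (Fin 3)) p ≤ (c : ℝ≥0∞))
    {T₁ T₀ g : ℝ} (hT₁ : T₁ ≤ 0) (hT₁T₀ : T₁ ≤ T₀) (hg : g ≠ 2 / 5) {W : EuclideanSpace ℝ (Fin 3) → EuclideanSpace ℝ (Fin 3)}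
    (hW : ∀ τ : ℝ, τ < T₁ → ∀ y, u τ y = (T₀ - τ) ^ (g - 1) • W ((T₀ - τ) ^ (-g) • y)) :
    uncurry u =ᵐ[volume.restrict (Iio (0 : ℝ) ×ˢ (univ : Set (EuclideanSpace ℝ (Fin 3))))] 0 := by
  rcases lt_or_gt_of_ne hg with hslow | hfast
  · exact ae_eq_zero_of_gauge_half_of_slowClock hsw hH hgauge hT₁ hT₁T₀ hslow hW
  · exact PastShape.ae_eq_zero_of_gauge_of_pastFastPowerClock (ρ := 1 / 2) (by norm_num) le_rfl hsw hH hgauge hT₁ hT₁T₀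
      (by linarith) hW

end PowerClock

end Summit.NavierStokesRegularity.NavierStokesRegularity.Theorems.PowerGaugeEulerLiouville

end
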